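import Summits.BirchSwinnertonDyer.Rank1Residual.AdditivePotMult.QuadraticTwistRamifiedPotMult
import Summits.BirchSwinnertonDyer.Rank1Residual.AdditivePotMult.QuadraticTwistTamagawaMultiplicative
import Literature.NumberTheory.DiophantineGeometry.LocalReductionProofs
import HarnessLib

/-!
# The unit twist at an ADDITIVE odd place `ℓ ∤ d`: additive again, same `ord Δ_min`, `c ≤ 4` on both
# sides (row T-MIL-ODD, FILE A-5a; seat n1011-p01 GEN 5)

HONEST FRAMING (cell `b2b-bsdres`, run/shared/lean/b2b/bsd-rank1-residual/, verbatim in every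
file): the goal of the cell is to DELETE the COMBINATION-SHAPED residual classes of the
Birch–Swinnerton-Dyer formula for ALL analytic-rank `≤ 1` elliptic curves over `ℚ` — "full BSD
formula for every rank `≤ 1` curve in class `C`" assembled STRICTLY from published theorems — so
that the rank-`≤ 1` remainder becomes exactly the CONSTRUCTION-SHAPED classes, which are TYPED
(missing-input `Prop`s), NOT attempted. This is not "finishing BSD". Sub-classes X3♯(M) / X4(M)
(additive, potentially multiplicative prime; base-change-and-descend): a RESEARCH ROUTE; they stay
CONSTRUCTION-SHAPED; nothing is booked by this file; no mark / label moved. THEOREMS ONLY: no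
definition, no named fact, no `sorry`.

## What and why (row T-MIL-ODD, `cells/n1011/skel/T-MIL-ODD.md`, §1 (A≥5), twist side)

At an additive place `v` of `W/ℚ` over an odd prime `ℓ ∤ d` the twist side of the local identity
(L_ℓ)@p needs `v_p(c_ℓ(W)) = v_p(c_ℓ(Wd)) = 0` for `p ≥ 5`: the unit twist `W^{(d)}` is again
ADDITIVE at `v` with the same `ord Δ_min` (tree DVR lemmas `isMinimal_quadraticTwist`,
`hasAdditiveReduction_quadraticTwist_iff`, `valuation_Δ_quadraticTwist` read in the number-field
currency exactly as FILE A-2a does at multiplicative places), and an additive place has `c ≤ 4`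
(FILE A-4M `localTamagawaNumber_le_four_of_hasAdditiveReductionAt`):

* `hasAdditiveReductionAt_quadraticTwist_of_not_dvd` — `W^{(d)}` additive at `v`, same
  `ord_v Δ_min`, twist equation `𝒪_v`-minimal after base change;
* `padicValNat_localTamagawaNumber_add_quadraticTwist_eq_zero_of_addv_of_five_le` —
  `v_p(c_v(W)) + v_p(c_v(W^{(d)})) = 0` for `p ≥ 5`.

HONEST LIMITS: TOOL theorems; `ℓ = 2`, the ramified twist of an additive place and the `p = 3`
entries (IV/IV* flip) are NOT treated (stage B); the base-change side at an additive place
(`W ⊗ K` additive at an unramified `𝔭`) is the named fact `kodairaSymbolAt_baseChange_of_ramificationIdx_eq_one`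
and is left to stage C by name; closes no class, discharges no fact by itself; nothing about any
curve is asserted. References: Silverman *AEC* VII.1 Prop. 1.3, VII.5 Prop. 5.1, X.5 Cor. 5.4;
*ATAEC* Cor. IV.9.2 (d).
-/

noncomputable section

open scoped Classical NumberField

open WeierstrassCurve NumberField IsDedekindDomain Rat.HeightOneSpectrum
  Literature.NumberTheory.EllipticCurves Literature.NumberTheory.EllipticCurves.Rank1Residual
  Literature.NumberTheory.GaloisRepresentations Field IsLocalRing
  Summit.BirchSwinnertonDyer.Rank1Residual.Additive

namespace Summit.BirchSwinnertonDyer.Rank1Residual.AdditivePotMult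

section AdditiveUnitTwist

variable (W : WeierstrassCurve ℚ) [W.IsElliptic] [W.IsGloballyMinimal] (v : HeightOneSpectrum (𝓞 ℚ))

/-- **The unit twist of an ADDITIVE odd place is additive with the same `ord Δ_min`.** For `W/ℚ`
globally minimal additive at `v` (over `ℓ` odd) and `ℓ ∤ d`: with `X = W ⊗ ℚ_v` minimal and
`d ∈ 𝒪_vˣ`, `X^{(d)}` is minimal (tree `isMinimal_quadraticTwist`), additive iff `X` is
(`hasAdditiveReduction_quadraticTwist_iff`), and `|Δ(X^{(d)})| = |d|⁶|Δ(X)| = |Δ(X)|`.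
[cite: SilvermanAEC2009, VII.5 Prop. 5.1(c) and X.5 Cor. 5.4] -/
theorem hasAdditiveReductionAt_quadraticTwist_of_not_dvd (hv2 : (primesEquiv v : ℕ) ≠ 2) {d : ℤ}
    (hd : ¬ ((primesEquiv v : ℕ) : ℤ) ∣ d) (hadd : W.HasAdditiveReductionAt v) :
    (W.quadraticTwist (d : ℚ)).HasAdditiveReductionAt v ∧
      (W.quadraticTwist (d : ℚ)).ordMinimalDiscriminant v = W.ordMinimalDiscriminant v := by
  have hd0 : (d : ℚ) ≠ 0 := by
    rintro h
    exact hd (by rw [Int.cast_eq_zero.mp h]; exact dvd_zero _)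
  haveI := W.isElliptic_quadraticTwist hd0
  haveI hXell : (W.baseChange (v.adicCompletion ℚ)).IsElliptic := by rw [baseChange]; infer_instance
  haveI hXmin : (W.baseChange (v.adicCompletion ℚ)).IsMinimal (v.adicCompletionIntegers ℚ) :=
    IsGloballyMinimal.isMinimalAt W v
  have h2 : IsUnit (2 : v.adicCompletionIntegers ℚ) := isUnit_two_adicCompletionIntegers v hv2
  haveI : NeZero (2 : v.adicCompletion ℚ) := ⟨two_ne_zero_of_isUnit_two _ h2⟩
  obtain ⟨d', hd'⟩ : ∃ d' : (v.adicCompletionIntegers ℚ)ˣ, (d' : v.adicCompletionIntegers ℚ) = d :=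
    ⟨(isUnit_adicCompletionIntegers_intCast v hd).unit, IsUnit.unit_spec _⟩
  have hcoe : algebraMap (v.adicCompletionIntegers ℚ) (v.adicCompletion ℚ)
      (d' : v.adicCompletionIntegers ℚ) = ((d : ℤ) : v.adicCompletion ℚ) := by
    rw [hd', map_intCast]
  have htw : (W.quadraticTwist (d : ℚ)).baseChange (v.adicCompletion ℚ) =
      (W.baseChange (v.adicCompletion ℚ)).quadraticTwist
        (algebraMap (v.adicCompletionIntegers ℚ) (v.adicCompletion ℚ) d') := by
    rw [baseChange, map_quadraticTwist, baseChange, map_intCast, hcoe]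
  haveI hYmin : ((W.baseChange (v.adicCompletion ℚ)).quadraticTwist
      (algebraMap (v.adicCompletionIntegers ℚ) (v.adicCompletion ℚ) d')).IsMinimal
        (v.adicCompletionIntegers ℚ) :=
    isMinimal_quadraticTwist _ _ h2 d'
  haveI hYmin' : ((W.quadraticTwist (d : ℚ)).baseChange (v.adicCompletion ℚ)).IsMinimal
      (v.adicCompletionIntegers ℚ) := by rw [htw]; exact hYmin
  have hΔX : (W.baseChange (v.adicCompletion ℚ)).Δ ≠ 0 :=
    (W.baseChange (v.adicCompletion ℚ)).isUnit_Δ.ne_zero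
  have hΔY : ((W.quadraticTwist (d : ℚ)).baseChange (v.adicCompletion ℚ)).Δ ≠ 0 := by
    haveI : ((W.quadraticTwist (d : ℚ)).baseChange (v.adicCompletion ℚ)).IsElliptic := by
      rw [baseChange]; infer_instance
    exact ((W.quadraticTwist (d : ℚ)).baseChange (v.adicCompletion ℚ)).isUnit_Δ.ne_zero
  -- the chosen local minimal models are `D • X`, `D' • Y`
  obtain ⟨D, hD⟩ : ∃ D : VariableChange (v.adicCompletion ℚ),
      W.localMinimalModel v = D • W.baseChange (v.adicCompletion ℚ) := ⟨_, rfl⟩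
  obtain ⟨D', hD'⟩ : ∃ D' : VariableChange (v.adicCompletion ℚ),
      (W.quadraticTwist (d : ℚ)).localMinimalModel v =
        D' • (W.quadraticTwist (d : ℚ)).baseChange (v.adicCompletion ℚ) := ⟨_, rfl⟩
  haveI : (D • W.baseChange (v.adicCompletion ℚ)).IsMinimal (v.adicCompletionIntegers ℚ) := by
    rw [← hD]; exact instIsMinimalLocalMinimalModel v W
  haveI : (D' • (W.quadraticTwist (d : ℚ)).baseChange (v.adicCompletion ℚ)).IsMinimal
      (v.adicCompletionIntegers ℚ) := by
    rw [← hD']; exact instIsMinimalLocalMinimalModel v (W.quadraticTwist (d : ℚ))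
  -- `X` is additive, hence `Y`
  have haddX : (W.baseChange (v.adicCompletion ℚ)).HasAdditiveReduction (v.adicCompletionIntegers ℚ) := by
    have h := hadd
    unfold HasAdditiveReductionAt at h
    rwa [hD, hasAdditiveReduction_iff_of_isMinimal_of_eq_smul _ rfl hΔX] at h
  have haddY := (hasAdditiveReduction_quadraticTwist_iff (v.adicCompletionIntegers ℚ)
    (X := W.baseChange (v.adicCompletion ℚ)) (d := d')).mpr haddX
  refine ⟨?_, ?_⟩
  · unfold HasAdditiveReductionAt
    rw [hD', hasAdditiveReduction_iff_of_isMinimal_of_eq_smul _ rfl hΔY, htw]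
    exact haddY
  · have hminQ : (W.quadraticTwist (d : ℚ)).IsMinimalAt v := by
      unfold IsMinimalAt; infer_instance
    have h1 := valuation_Δ_eq_of_isMinimalAt_holds v (W.quadraticTwist (d : ℚ)) hminQ
    have h2' := valuation_Δ_eq_of_isMinimalAt_holds v W (IsGloballyMinimal.isMinimalAt W v)
    have hdv : v.valuation ℚ (d : ℚ) = 1 := valuation_ringOfIntegers_intCast_eq_one v hd
    rw [quadraticTwist_Δ, map_mul, map_pow, hdv, one_pow, one_mul, h2', WithZero.exp_inj,
      neg_inj, Nat.cast_inj] at h1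
    exact h1.symm

/-- **`v_p(c_v(W)) + v_p(c_v(W^{(d)})) = 0` for `p ≥ 5` at an additive odd place with `ℓ ∤ d`**:
both curves are additive at `v`, so both Tamagawa numbers are `≤ 4`
(`localTamagawaNumber_le_four_of_hasAdditiveReductionAt`). The twist-side entry of (L_ℓ)@p at an
additive unramified `ℓ` for `p ≥ 5`. [cite: SilvermanATAEC1994, Cor. IV.9.2(d) (PDF p. 340)] -/
theorem padicValNat_localTamagawaNumber_add_quadraticTwist_eq_zero_of_addv_of_five_le
    (hv2 : (primesEquiv v : ℕ) ≠ 2) {d : ℤ} (hd : ¬ ((primesEquiv v : ℕ) : ℤ) ∣ d)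
    (hadd : W.HasAdditiveReductionAt v) (p : ℕ) [Fact p.Prime] (h5 : 5 ≤ p) :
    padicValNat p ((W.baseChange (v.adicCompletion ℚ)).localTamagawaNumber
        (v.adicCompletionIntegers ℚ)) +
      padicValNat p (((W.quadraticTwist (d : ℚ)).baseChange (v.adicCompletion ℚ)).localTamagawaNumber
        (v.adicCompletionIntegers ℚ)) = 0 := by
  have hd0 : (d : ℚ) ≠ 0 := by
    rintro h
    exact hd (by rw [Int.cast_eq_zero.mp h]; exact dvd_zero _)
  haveI := W.isElliptic_quadraticTwist hd0
  rw [padicValNat_localTamagawaNumber_eq_zero_of_hasAdditiveReductionAt_of_five_le W v hadd p h5,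
    padicValNat_localTamagawaNumber_eq_zero_of_hasAdditiveReductionAt_of_five_le
      (W.quadraticTwist (d : ℚ)) v
      (hasAdditiveReductionAt_quadraticTwist_of_not_dvd W v hv2 hd hadd).1 p h5]

end AdditiveUnitTwist

end Summit.BirchSwinnertonDyer.Rank1Residual.AdditivePotMult

end
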